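import Mathlib
import Literature.AlgebraicGeometry.Resolution.PlaneGermBlowup
import Literature.AlgebraicGeometry.Resolution.WeightedShear
import Literature.AlgebraicGeometry.Resolution.PlaneGermBlowupCalculus

/-!
# `WeightedInvariant.LocalWeightedDrop`, line `hasse-ridge-face-selection`: order of strict transforms

Crux item stmt-ResolutionOfSingularities-8899 (route `ResolutionOfSingularities/WeightedInvariant`),
skeleton v14 of the line `hasse-ridge-face-selection`, stub `stub_strictTransformOrder`, PROVED here
(statement verbatim from the ledger registration).

**Statement (folklore: the strict transform of a plane curve germ does not gain order).**  For
`g ∈ k[[x, y]]` (`x = X 0`, `y = X 1`, `k` a field) of order `m` and a chart `Φ` of the point blow-up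
(`Φ = PlaneGerm.dirChart t = (x, x (t + y))` or `Φ = PlaneGerm.vertChart = (x y, x)`), write
`g∘Φ = x^m · h` (`h` = the strict transform).  Then
(A1) `ord h ≤ m`;
(A2) if `ord h = m` then `coeff (0, m) h ≠ 0` (the new germ contains `y^m`: its tangent cone is not the
exceptional line `x = 0`);
(A3) if `coeff (0, m) g ≠ 0` then at the VERTICAL point the strict transform is a unit
(`constantCoeff h ≠ 0`).

**Proof.**  Coefficients are transported along the monomial substitutions:
`coeff (p + q, q) g(x, x y) = coeff (p, q) g` (`PlaneGerm.coeff_subst_blow`) and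
`coeff (p + q, p) g(x y, x) = coeff (p, q) g` (`PlaneGerm.coeff_subst_vertChart`), while
`coeff (m + P, Q) (x^m · h) = coeff (P, Q) h` (`MvPowerSeries.coeff_monomial_mul`).  The chart of slope
`t` is the shear `(x, y + t x)` followed by `(x, x y)` (`PlaneGerm.subst_dirChart`), and the shear is a
formal coordinate change, so it preserves the order (`WeightedShear.order_subst_of_isUnit_det`).  Hence
in either chart a non-zero coefficient of degree `m` of `g` (resp. of the sheared `g`), which exists by
`MvPowerSeries.order_eq_nat`, reappears as `coeff (0, j) h ≠ 0` for some `j ≤ m`: this gives (A1)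
(`MvPowerSeries.order_le`), and (A2) because `ord h = m > j` would force `coeff (0, j) h = 0`
(`MvPowerSeries.coeff_of_lt_order`).  (A3): `constantCoeff h = coeff (m, 0) g(x y, x) = coeff (0, m) g`.
-/

set_option linter.dupNamespace false -- mandated namespace of this single-conjunct summit

namespace Summit.ResolutionOfSingularities.ResolutionOfSingularities.Theorems

open Literature.AlgebraicGeometry.Resolution

namespace StrictTransformOrder

open MvPowerSeries

variable {k : Type} [Field k]

/-! ### Coefficient bookkeeping -/

/-- `coeff (m + P, Q) (x^m · h) = coeff (P, Q) h`. -/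
theorem coeff_single_add_X_pow_mul (m : ℕ) (e : Fin 2 →₀ ℕ) (h : MvPowerSeries (Fin 2) k) :
    coeff (Finsupp.single 0 m + e) (X 0 ^ m * h) = coeff e h := by
  rw [X_pow_eq, coeff_monomial_mul, if_pos le_self_add, one_mul, add_tsub_cancel_left]

/-! ### A degree-`m` coefficient of `g` survives as an `x`-free coefficient of the strict transform -/

/-- Chart `(x, x y)`: if `ord g = m` and `g(x, x y) = x^m · h` then `coeff (0, j) h ≠ 0` for some
`j ≤ m`. -/
theorem exists_coeff_single_ne_zero_blow {g h : MvPowerSeries (Fin 2) k} {m : ℕ} (hg : g.order = m)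
    (hsub : subst (![X 0, X 0 * X 1] : Fin 2 → MvPowerSeries (Fin 2) k) g = X 0 ^ m * h) :
    ∃ j ≤ m, coeff (Finsupp.single 1 j) h ≠ 0 := by
  obtain ⟨⟨d, hd, hdeg⟩, -⟩ := order_eq_nat.mp hg
  rw [Finsupp.degree_eq_sum, Fin.sum_univ_two] at hdeg
  refine ⟨d 1, by omega, ?_⟩
  have key := PlaneGerm.coeff_subst_blow g d
  rw [hsub, hdeg, coeff_single_add_X_pow_mul] at key
  rwa [key]

/-- Vertical chart `(x y, x)`: if `ord g = m` and `g(x y, x) = x^m · h` then `coeff (0, j) h ≠ 0` for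
some `j ≤ m`. -/
theorem exists_coeff_single_ne_zero_vert {g h : MvPowerSeries (Fin 2) k} {m : ℕ} (hg : g.order = m)
    (hsub : subst (PlaneGerm.vertChart k) g = X 0 ^ m * h) :
    ∃ j ≤ m, coeff (Finsupp.single 1 j) h ≠ 0 := by
  obtain ⟨⟨d, hd, hdeg⟩, -⟩ := order_eq_nat.mp hg
  rw [Finsupp.degree_eq_sum, Fin.sum_univ_two] at hdeg
  refine ⟨d 0, by omega, ?_⟩
  have key := PlaneGerm.coeff_subst_vertChart g d
  rw [hsub, hdeg, coeff_single_add_X_pow_mul] at key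
  rwa [key]

/-- Either chart: if `ord g = m` and `g∘Φ = x^m · h` then `coeff (0, j) h ≠ 0` for some `j ≤ m`
(the chart of slope `t` is the order-preserving shear `(x, y + t x)` followed by `(x, x y)`). -/
theorem exists_coeff_single_ne_zero {Φ : Fin 2 → MvPowerSeries (Fin 2) k}
    (hΦ : (∃ t : k, Φ = PlaneGerm.dirChart t) ∨ Φ = PlaneGerm.vertChart k)
    {g h : MvPowerSeries (Fin 2) k} {m : ℕ} (hg : g.order = m) (hsub : subst Φ g = X 0 ^ m * h) :
    ∃ j ≤ m, coeff (Finsupp.single 1 j) h ≠ 0 := by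
  rcases hΦ with ⟨t, rfl⟩ | rfl
  · rw [PlaneGerm.subst_dirChart] at hsub
    refine exists_coeff_single_ne_zero_blow ?_ hsub
    rw [WeightedShear.order_subst_of_isUnit_det (PlaneGerm.constantCoeff_shearX t)
      (PlaneGerm.isUnit_det_shearX t)]
    exact hg
  · exact exists_coeff_single_ne_zero_vert hg hsub

/-! ### The three clauses -/

/-- (A1) The strict transform does not gain order. -/
theorem order_strictTransform_le {Φ : Fin 2 → MvPowerSeries (Fin 2) k}
    (hΦ : (∃ t : k, Φ = PlaneGerm.dirChart t) ∨ Φ = PlaneGerm.vertChart k)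
    {g h : MvPowerSeries (Fin 2) k} {m : ℕ} (hg : g.order = m) (hsub : subst Φ g = X 0 ^ m * h) :
    h.order ≤ m := by
  obtain ⟨j, hj, hne⟩ := exists_coeff_single_ne_zero hΦ hg hsub
  have h1 : h.order ≤ j := by
    have h2 := MvPowerSeries.order_le hne
    rwa [Finsupp.degree_single] at h2
  exact h1.trans (by exact_mod_cast hj)

/-- (A2) If the strict transform keeps the order `m`, it contains `y^m`. -/
theorem coeff_single_strictTransform_ne_zero {Φ : Fin 2 → MvPowerSeries (Fin 2) k}
    (hΦ : (∃ t : k, Φ = PlaneGerm.dirChart t) ∨ Φ = PlaneGerm.vertChart k)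
    {g h : MvPowerSeries (Fin 2) k} {m : ℕ} (hg : g.order = m) (hsub : subst Φ g = X 0 ^ m * h)
    (hh : h.order = m) : coeff (Finsupp.single 1 m) h ≠ 0 := by
  obtain ⟨j, hj, hne⟩ := exists_coeff_single_ne_zero hΦ hg hsub
  rcases hj.lt_or_eq with hlt | rfl
  · refine absurd (coeff_of_lt_order ?_) hne
    rw [hh, Finsupp.degree_single]
    exact_mod_cast hlt
  · exact hne

/-- (A3) A germ containing `y^m` has a unit strict transform at the vertical point. -/
theorem constantCoeff_strictTransform_ne_zero {g h : MvPowerSeries (Fin 2) k} {m : ℕ}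
    (hg : coeff (Finsupp.single 1 m) g ≠ 0) (hsub : subst (PlaneGerm.vertChart k) g = X 0 ^ m * h) :
    constantCoeff h ≠ 0 := by
  have key := PlaneGerm.coeff_subst_vertChart g (Finsupp.single 1 m)
  have h0 : (Finsupp.single (1 : Fin 2) m) 0 = 0 := Finsupp.single_eq_of_ne (by decide)
  rw [h0, Finsupp.single_eq_same, zero_add, Finsupp.single_zero, hsub,
    coeff_single_add_X_pow_mul, coeff_zero_eq_constantCoeff_apply] at key
  rwa [key]

end StrictTransformOrder

/-- Stub `stub_strictTransformOrder` of the line `hasse-ridge-face-selection` (skeleton v14): three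
folklore facts about the strict transform `h` of a plane germ `g` of order `m` in a chart `Φ` of the point
blow-up (`g∘Φ = x^m · h`): (A1) `ord h ≤ m`; (A2) `ord h = m ⟹ coeff (0, m) h ≠ 0`; (A3) at the vertical
point, `coeff (0, m) g ≠ 0 ⟹ h` is a unit. -/
theorem stub_strictTransformOrder : ∀ (k : Type) [Field k],
    (∀ (Φ : Fin 2 → MvPowerSeries (Fin 2) k), ((∃ t : k, Φ = PlaneGerm.dirChart t) ∨ Φ = PlaneGerm.vertChart k) →
      ∀ (g h : MvPowerSeries (Fin 2) k) (m : ℕ), g.order = m →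
        MvPowerSeries.subst Φ g = MvPowerSeries.X 0 ^ m * h → h.order ≤ m) ∧
    (∀ (Φ : Fin 2 → MvPowerSeries (Fin 2) k), ((∃ t : k, Φ = PlaneGerm.dirChart t) ∨ Φ = PlaneGerm.vertChart k) →
      ∀ (g h : MvPowerSeries (Fin 2) k) (m : ℕ), g.order = m →
        MvPowerSeries.subst Φ g = MvPowerSeries.X 0 ^ m * h → h.order = m →
        MvPowerSeries.coeff (Finsupp.single 1 m) h ≠ 0) ∧
    (∀ (g h : MvPowerSeries (Fin 2) k) (m : ℕ), g.order = m →
      MvPowerSeries.coeff (Finsupp.single 1 m) g ≠ 0 →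
      MvPowerSeries.subst (PlaneGerm.vertChart k) g = MvPowerSeries.X 0 ^ m * h →
      MvPowerSeries.constantCoeff h ≠ 0) := by
  intro k _
  exact ⟨fun Φ hΦ g h m hg hsub => StrictTransformOrder.order_strictTransform_le hΦ hg hsub,
    fun Φ hΦ g h m hg hsub hh => StrictTransformOrder.coeff_single_strictTransform_ne_zero hΦ hg hsub hh,
    fun g h m _ hgm hsub => StrictTransformOrder.constantCoeff_strictTransform_ne_zero hgm hsub⟩

end Summit.ResolutionOfSingularities.ResolutionOfSingularities.Theorems
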